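import Summits.Ventures.YMGap.RobustBall.HaarSecondMoments
import Literature.MathematicalPhysics.QuantumLattice.NarrowWellPlaquetteAction
import HarnessLib

/-!
# Venture YMGap, track ROBUST-BALL — `SU(2)` HAAR ALGEBRA OF TWO STAPLES:
# `∫ (Re tr(Ua) + Re tr(Ub))² dU = 2 + Re tr(b⁻¹a)`

HONEST FRAMING. WHAT THIS IS: a venture file (cell `pub-ymgap`, track Y2 ROBUST-BALL, seat ds-3, theorems only; step 4 of the
non-degeneracy «C-CLT-ND» of the plaquette central limit theorem): the one-link Haar computation behind the susceptibility floor.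
A link of `ℤ^d` interior to a family of equally oriented plaquettes lies in exactly two of them; on the one-link fibre their sum is
`U ↦ Re tr(Ua) + Re tr(Ub)` (`a, b ∈ SU(2)` the two staples), and under Haar measure on `SU(2)`:
* `trace_re_inv` — `Re tr(A⁻¹) = Re tr(A)` on `SU(N)` (the trace of `SU(2)` is real: tree `NarrowWell.trace_im_eq_zero`);
* `integral_trace_re_su2 = 0`, `integral_trace_re_sq_su2 = 1`, `integral_trace_re_mul_right_su2` (right invariance);
* ★ `integral_trace_mul_re_mul_trace_re_su2` — `∫ Re tr(Ug) · Re tr(U) dU = Re tr(g) / 2` (Schur orthogonality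
  `HaarSecondMoments.integral_entry_mul_conj_entry_suN`, `∫ U_{ai} conj(U_{bk}) = δ_{ab}δ_{ik}/2`);
* ★★ `integral_two_staple_sq_su2` — `∫ (Re tr(Ua) + Re tr(Ub))² dU = 2 + Re tr(b⁻¹a)` and `integral_two_staple_su2 = 0`:
  the fibre variance of the two plaquettes through a link is `2 + W_{1×2}` (`W_{1×2} = Re tr(b⁻¹a)` the `1×2` Wilson loop around them),
  which is `≥ 0` always and has DLR-mean `≥ 2 − 8(d−1)|β|` (next file).
WHAT THIS IS NOT: nothing about `SU(N)`, `N ≥ 3` (there `∫ (Re tr(Ua) + Re tr(Ub))² = 1 + Re tr(b⁻¹a)/2`, not needed here).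
References: M. Creutz, Quarks, Gluons and Lattices (1983) (8.20); folklore.
-/

noncomputable section

open MeasureTheory Complex ComplexConjugate Finset
open Literature.MathematicalPhysics.QuantumLattice Literature.MathematicalPhysics.QuantumFieldTheory

namespace Summit.Ventures.YMGap.RobustBall

namespace SU2TwoStaple

/-! ### Traces on `SU(N)` and `SU(2)` -/

/-- `Re tr(A⁻¹) = Re tr(A)` on `SU(N)` (`A⁻¹ = Aᴴ`). [folklore] -/
theorem trace_re_inv {N : ℕ} (A : Matrix.specialUnitaryGroup (Fin N) ℂ) :
    ((A⁻¹ : Matrix.specialUnitaryGroup (Fin N) ℂ) : Matrix (Fin N) (Fin N) ℂ).trace.re = (A : Matrix (Fin N) (Fin N) ℂ).trace.re := by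
  rw [← Matrix.star_eq_inv, Matrix.specialUnitaryGroup.coe_star, Matrix.star_eq_conjTranspose, Matrix.trace_conjTranspose,
    Complex.star_def, Complex.conj_re]

/-- For `SU(2)` matrices `z = tr(Ug)`, `w = tr(U)` (both real): `Re z · Re w = Re(z · conj w)`. [folklore] -/
theorem re_mul_re_eq_re_mul_conj {z w : ℂ} (hz : z.im = 0) : z.re * w.re = (z * conj w).re := by
  simp [Complex.mul_re, Complex.conj_re, Complex.conj_im, hz]

/-! ### First and second Haar moments of the trace on `SU(2)` -/

/-- Continuous real functions on `SU(2)` are Haar integrable. [folklore] -/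
theorem integrable_of_continuous_su2 {F : Matrix.specialUnitaryGroup (Fin 2) ℂ → ℝ} (hF : Continuous F) :
    Integrable F (haarProbability (Matrix.specialUnitaryGroup (Fin 2) ℂ)) :=
  hF.integrable_of_hasCompactSupport (HasCompactSupport.of_compactSpace _)

/-- `U ↦ Re tr(U g)` is continuous on `SU(2)`. [folklore] -/
theorem continuous_trace_re_mul (g : Matrix.specialUnitaryGroup (Fin 2) ℂ) :
    Continuous fun U : Matrix.specialUnitaryGroup (Fin 2) ℂ => ((U * g : Matrix.specialUnitaryGroup (Fin 2) ℂ) : Matrix (Fin 2) (Fin 2) ℂ).trace.re :=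
  Complex.continuous_re.comp ((continuous_subtype_val.comp (continuous_id.mul continuous_const)).matrix_trace)

/-- `∫ Re tr(U) dU = 0` on `SU(2)` (centre twist `U ↦ −U`). [folklore] -/
theorem integral_trace_re_su2 :
    ∫ U, ((U : Matrix (Fin 2) (Fin 2) ℂ).trace).re ∂haarProbability (Matrix.specialUnitaryGroup (Fin 2) ℂ) = 0 := by
  have h := PlaquetteLowerBound.integral_reTr_eq_zero (fundamentalRep (Fin 2)) (TorusAreaLaw.isSpecialUnitaryModel_fundamentalRep 2) le_rfl
  simpa only [PlaquetteLowerBound.reTr, fundamentalRep_apply] using h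

/-- `∫ (Re tr U)² dU = 1` on `SU(2)` (`HaarSecondMoments.charVariance_su2`). [folklore] -/
theorem integral_trace_re_sq_su2 :
    ∫ U, ((U : Matrix (Fin 2) (Fin 2) ℂ).trace).re ^ 2 ∂haarProbability (Matrix.specialUnitaryGroup (Fin 2) ℂ) = 1 := by
  have h := HaarSecondMoments.charVariance_su2
  simpa only [PlaquetteLowerBound.charVariance, PlaquetteLowerBound.reTr, fundamentalRep_apply] using h

/-- Right invariance: `∫ F(Re tr(U g)) dU = ∫ F(Re tr U) dU`. [folklore] -/
theorem integral_comp_trace_re_mul_right_su2 (g : Matrix.specialUnitaryGroup (Fin 2) ℂ) (F : ℝ → ℝ) :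
    ∫ U, F ((U * g : Matrix.specialUnitaryGroup (Fin 2) ℂ) : Matrix (Fin 2) (Fin 2) ℂ).trace.re
        ∂haarProbability (Matrix.specialUnitaryGroup (Fin 2) ℂ) =
      ∫ U, F ((U : Matrix (Fin 2) (Fin 2) ℂ).trace).re ∂haarProbability (Matrix.specialUnitaryGroup (Fin 2) ℂ) :=
  integral_mul_right_eq_self (μ := haarProbability (Matrix.specialUnitaryGroup (Fin 2) ℂ))
    (fun U : Matrix.specialUnitaryGroup (Fin 2) ℂ => F ((U : Matrix (Fin 2) (Fin 2) ℂ).trace).re) g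

/-! ### ★ The cross moment `∫ Re tr(Ug) Re tr(U) dU = Re tr(g)/2` -/

/-- **Schur cross moment, complex form**: `∫ tr(Ug) · conj(tr U) dU = tr(g)/2` on `SU(2)`
(`∫ U_{ai} conj(U_{bk}) dU = δ_{ab}δ_{ik}/2`). [folklore] -/
theorem integral_trace_mul_mul_conj_trace_su2 (g : Matrix.specialUnitaryGroup (Fin 2) ℂ) :
    ∫ U, ((U : Matrix (Fin 2) (Fin 2) ℂ) * (g : Matrix (Fin 2) (Fin 2) ℂ)).trace * conj ((U : Matrix (Fin 2) (Fin 2) ℂ).trace)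
        ∂haarProbability (Matrix.specialUnitaryGroup (Fin 2) ℂ) = (g : Matrix (Fin 2) (Fin 2) ℂ).trace / 2 := by
  have hexp : ∀ U : Matrix.specialUnitaryGroup (Fin 2) ℂ,
      ((U : Matrix (Fin 2) (Fin 2) ℂ) * (g : Matrix (Fin 2) (Fin 2) ℂ)).trace * conj ((U : Matrix (Fin 2) (Fin 2) ℂ).trace) =
        ∑ p : Fin 2 × Fin 2 × Fin 2, (g : Matrix (Fin 2) (Fin 2) ℂ) p.2.1 p.1 *
          ((U : Matrix (Fin 2) (Fin 2) ℂ) p.1 p.2.1 * conj ((U : Matrix (Fin 2) (Fin 2) ℂ) p.2.2 p.2.2)) := by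
    intro U
    simp only [Matrix.trace, Matrix.diag_apply, Matrix.mul_apply, map_add, Fintype.sum_prod_type, Fin.sum_univ_two]
    ring
  simp_rw [hexp]
  have hint : ∀ a i b k : Fin 2, Integrable (fun U : Matrix.specialUnitaryGroup (Fin 2) ℂ =>
      (U : Matrix (Fin 2) (Fin 2) ℂ) a i * conj ((U : Matrix (Fin 2) (Fin 2) ℂ) b k)) (haarProbability (Matrix.specialUnitaryGroup (Fin 2) ℂ)) :=
    fun a i b k => by
      simpa only [fundamentalRep_apply] using
        HaarSecondMoments.integrable_entry_mul_conj_entry (fundamentalRep (Fin 2)) (continuous_fundamentalRep (Fin 2)) a i b k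
  rw [integral_finsetSum _ fun p _ => (hint p.1 p.2.1 p.2.2 p.2.2).const_mul _]
  simp_rw [integral_const_mul, HaarSecondMoments.integral_entry_mul_conj_entry_suN]
  simp only [Fintype.sum_prod_type, Fin.sum_univ_two, Matrix.trace, Matrix.diag_apply]
  simp
  ring

/-- ★ **Schur cross moment, real form**: `∫ Re tr(Ug) · Re tr(U) dU = Re tr(g) / 2` on `SU(2)`. [folklore] -/
theorem integral_trace_mul_re_mul_trace_re_su2 (g : Matrix.specialUnitaryGroup (Fin 2) ℂ) :
    ∫ U, ((U * g : Matrix.specialUnitaryGroup (Fin 2) ℂ) : Matrix (Fin 2) (Fin 2) ℂ).trace.re * ((U : Matrix (Fin 2) (Fin 2) ℂ).trace).re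
        ∂haarProbability (Matrix.specialUnitaryGroup (Fin 2) ℂ) = ((g : Matrix (Fin 2) (Fin 2) ℂ).trace).re / 2 := by
  have hre : ∀ U : Matrix.specialUnitaryGroup (Fin 2) ℂ,
      ((U * g : Matrix.specialUnitaryGroup (Fin 2) ℂ) : Matrix (Fin 2) (Fin 2) ℂ).trace.re * ((U : Matrix (Fin 2) (Fin 2) ℂ).trace).re =
        (((U : Matrix (Fin 2) (Fin 2) ℂ) * (g : Matrix (Fin 2) (Fin 2) ℂ)).trace * conj ((U : Matrix (Fin 2) (Fin 2) ℂ).trace)).re := by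
    intro U
    have hc : ((U * g : Matrix.specialUnitaryGroup (Fin 2) ℂ) : Matrix (Fin 2) (Fin 2) ℂ) =
        (U : Matrix (Fin 2) (Fin 2) ℂ) * (g : Matrix (Fin 2) (Fin 2) ℂ) := rfl
    have him := NarrowWell.trace_im_eq_zero (U * g)
    rw [hc] at him ⊢
    exact re_mul_re_eq_re_mul_conj him
  simp_rw [hre]
  have hint : Integrable (fun U : Matrix.specialUnitaryGroup (Fin 2) ℂ =>
      ((U : Matrix (Fin 2) (Fin 2) ℂ) * (g : Matrix (Fin 2) (Fin 2) ℂ)).trace * conj ((U : Matrix (Fin 2) (Fin 2) ℂ).trace))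
      (haarProbability (Matrix.specialUnitaryGroup (Fin 2) ℂ)) :=
    (((continuous_subtype_val.mul continuous_const).matrix_trace).mul
      (Complex.continuous_conj.comp continuous_subtype_val.matrix_trace)).integrable_of_hasCompactSupport
      (HasCompactSupport.of_compactSpace _)
  have h := integral_re hint
  simp only [RCLike.re_to_complex] at h
  rw [h, integral_trace_mul_mul_conj_trace_su2, Complex.div_ofNat_re]

/-! ### ★★ Two staples -/

/-- ★★ **TWO-STAPLE SECOND MOMENT**: `∫ (Re tr(Ua) + Re tr(Ub))² dU = 2 + Re tr(b⁻¹a)` on `SU(2)` (right-translate by `b⁻¹`, expand: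
`1 + 1 + 2 · Re tr(b⁻¹a)/2`). [folklore] -/
theorem integral_two_staple_sq_su2 (a b : Matrix.specialUnitaryGroup (Fin 2) ℂ) :
    ∫ U, (((U * a : Matrix.specialUnitaryGroup (Fin 2) ℂ) : Matrix (Fin 2) (Fin 2) ℂ).trace.re +
        ((U * b : Matrix.specialUnitaryGroup (Fin 2) ℂ) : Matrix (Fin 2) (Fin 2) ℂ).trace.re) ^ 2
        ∂haarProbability (Matrix.specialUnitaryGroup (Fin 2) ℂ) =
      2 + ((b⁻¹ * a : Matrix.specialUnitaryGroup (Fin 2) ℂ) : Matrix (Fin 2) (Fin 2) ℂ).trace.re := by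
  set g : Matrix.specialUnitaryGroup (Fin 2) ℂ := b⁻¹ * a with hg
  -- right-translate by `b⁻¹`
  have hsub := integral_mul_right_eq_self (μ := haarProbability (Matrix.specialUnitaryGroup (Fin 2) ℂ))
    (fun U : Matrix.specialUnitaryGroup (Fin 2) ℂ => (((U * a : Matrix.specialUnitaryGroup (Fin 2) ℂ) : Matrix (Fin 2) (Fin 2) ℂ).trace.re +
        ((U * b : Matrix.specialUnitaryGroup (Fin 2) ℂ) : Matrix (Fin 2) (Fin 2) ℂ).trace.re) ^ 2) b⁻¹
  simp only [inv_mul_cancel_right] at hsub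
  rw [← hsub]
  have hrw : ∀ U : Matrix.specialUnitaryGroup (Fin 2) ℂ, U * b⁻¹ * a = U * g := fun U => by rw [hg, mul_assoc]
  simp_rw [hrw]
  -- expand the square
  have hexp : ∀ U : Matrix.specialUnitaryGroup (Fin 2) ℂ,
      (((U * g : Matrix.specialUnitaryGroup (Fin 2) ℂ) : Matrix (Fin 2) (Fin 2) ℂ).trace.re + ((U : Matrix (Fin 2) (Fin 2) ℂ).trace).re) ^ 2 =
        ((U * g : Matrix.specialUnitaryGroup (Fin 2) ℂ) : Matrix (Fin 2) (Fin 2) ℂ).trace.re ^ 2 + ((U : Matrix (Fin 2) (Fin 2) ℂ).trace).re ^ 2 +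
          2 * (((U * g : Matrix.specialUnitaryGroup (Fin 2) ℂ) : Matrix (Fin 2) (Fin 2) ℂ).trace.re * ((U : Matrix (Fin 2) (Fin 2) ℂ).trace).re) :=
    fun U => by ring
  simp_rw [hexp]
  have hc1 : Continuous fun U : Matrix.specialUnitaryGroup (Fin 2) ℂ =>
      ((U * g : Matrix.specialUnitaryGroup (Fin 2) ℂ) : Matrix (Fin 2) (Fin 2) ℂ).trace.re := continuous_trace_re_mul g
  have hc0 : Continuous fun U : Matrix.specialUnitaryGroup (Fin 2) ℂ => ((U : Matrix (Fin 2) (Fin 2) ℂ).trace).re :=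
    Complex.continuous_re.comp continuous_subtype_val.matrix_trace
  have i1 : Integrable (fun U : Matrix.specialUnitaryGroup (Fin 2) ℂ =>
      ((U * g : Matrix.specialUnitaryGroup (Fin 2) ℂ) : Matrix (Fin 2) (Fin 2) ℂ).trace.re ^ 2) (haarProbability _) :=
    integrable_of_continuous_su2 (hc1.pow 2)
  have i2 : Integrable (fun U : Matrix.specialUnitaryGroup (Fin 2) ℂ => ((U : Matrix (Fin 2) (Fin 2) ℂ).trace).re ^ 2) (haarProbability _) :=
    integrable_of_continuous_su2 (hc0.pow 2)
  have i3 : Integrable (fun U : Matrix.specialUnitaryGroup (Fin 2) ℂ =>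
      2 * (((U * g : Matrix.specialUnitaryGroup (Fin 2) ℂ) : Matrix (Fin 2) (Fin 2) ℂ).trace.re * ((U : Matrix (Fin 2) (Fin 2) ℂ).trace).re))
      (haarProbability _) :=
    integrable_of_continuous_su2 (continuous_const.mul (hc1.mul hc0))
  have i12 : Integrable (fun U : Matrix.specialUnitaryGroup (Fin 2) ℂ =>
      ((U * g : Matrix.specialUnitaryGroup (Fin 2) ℂ) : Matrix (Fin 2) (Fin 2) ℂ).trace.re ^ 2 + ((U : Matrix (Fin 2) (Fin 2) ℂ).trace).re ^ 2)
      (haarProbability _) := i1.add i2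
  rw [integral_add i12 i3, integral_add i1 i2, integral_const_mul, integral_trace_mul_re_mul_trace_re_su2,
    integral_comp_trace_re_mul_right_su2 g (fun r => r ^ 2), integral_trace_re_sq_su2]
  ring

/-- **Two-staple first moment**: `∫ (Re tr(Ua) + Re tr(Ub)) dU = 0` on `SU(2)`. [folklore] -/
theorem integral_two_staple_su2 (a b : Matrix.specialUnitaryGroup (Fin 2) ℂ) :
    ∫ U, (((U * a : Matrix.specialUnitaryGroup (Fin 2) ℂ) : Matrix (Fin 2) (Fin 2) ℂ).trace.re +
        ((U * b : Matrix.specialUnitaryGroup (Fin 2) ℂ) : Matrix (Fin 2) (Fin 2) ℂ).trace.re)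
        ∂haarProbability (Matrix.specialUnitaryGroup (Fin 2) ℂ) = 0 := by
  rw [integral_add (integrable_of_continuous_su2 (continuous_trace_re_mul a)) (integrable_of_continuous_su2 (continuous_trace_re_mul b)),
    integral_comp_trace_re_mul_right_su2 a (fun r => r), integral_comp_trace_re_mul_right_su2 b (fun r => r), integral_trace_re_su2,
    add_zero]

/-- ★★ **TWO-STAPLE HAAR VARIANCE** `= 2 + Re tr(b⁻¹a)`: `∫ (F − ∫F)² dU = 2 + Re tr(b⁻¹a)` for `F(U) = Re tr(Ua) + Re tr(Ub)`. [folklore] -/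
theorem variance_two_staple_su2 (a b : Matrix.specialUnitaryGroup (Fin 2) ℂ) :
    ∫ U, ((((U * a : Matrix.specialUnitaryGroup (Fin 2) ℂ) : Matrix (Fin 2) (Fin 2) ℂ).trace.re +
        ((U * b : Matrix.specialUnitaryGroup (Fin 2) ℂ) : Matrix (Fin 2) (Fin 2) ℂ).trace.re) -
        ∫ U', (((U' * a : Matrix.specialUnitaryGroup (Fin 2) ℂ) : Matrix (Fin 2) (Fin 2) ℂ).trace.re +
          ((U' * b : Matrix.specialUnitaryGroup (Fin 2) ℂ) : Matrix (Fin 2) (Fin 2) ℂ).trace.re)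
          ∂haarProbability (Matrix.specialUnitaryGroup (Fin 2) ℂ)) ^ 2
        ∂haarProbability (Matrix.specialUnitaryGroup (Fin 2) ℂ) =
      2 + ((b⁻¹ * a : Matrix.specialUnitaryGroup (Fin 2) ℂ) : Matrix (Fin 2) (Fin 2) ℂ).trace.re := by
  simp_rw [integral_two_staple_su2 a b, sub_zero]
  exact integral_two_staple_sq_su2 a b

end SU2TwoStaple

end Summit.Ventures.YMGap.RobustBall

end
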